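import Mathlib.Analysis.Convex.Combination
import Mathlib.Data.Real.Basic
import Mathlib.Tactic.Linarith
import Mathlib.Tactic.FieldSimp
import Mathlib.Tactic.Positivity
import HarnessLib

/-!
# The hypersimplex is the convex hull of its `0/1` points

Topic `Literature/Analysis/Convex`. For a finite index set `κ` and `N ∈ ℕ` the **hypersimplex**
`Δ(N, κ) = {l ∈ [0,1]^κ : Σ_k l_k = N}` coincides with the convex hull of the indicator vectors
`𝟙_S` of the `N`-element subsets `S ⊆ κ` (a `0/1`-polytope; S. Herrmann, *On the facets of the
secondary polytope*, J. Combin. Theory Ser. A 118 (2011) 425–447, arXiv:0908.2537, §6, first display; equivalently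
Hoffman–Kruskal integrality for the totally unimodular system `0 ≤ l ≤ 1`, `Σ l = N`). We prove the
non-trivial inclusion in the explicit finite form used downstream (Coleman's ensemble
`N`-representability theorem for the one-matrix,
`Literature/MathematicalPhysics/QuantumChemistry/ColemanOneMatrixRepresentability.lean`, where `l` is
the vector of natural occupation numbers):

* `exists_convexCombination_indicator` — every `l : κ → ℝ` with `0 ≤ l ≤ 1` and `Σ_k l_k = N`
  admits weights `w : Finset κ → ℝ`, `w ≥ 0`, `Σ_S w_S = 1`, `w_S = 0` unless `|S| = N`, with
  `l_k = Σ_S w_S [k ∈ S]` for every `k`.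

PROOF (standard, by induction on the number of coordinates strictly between `0` and `1`): if there
is none, `l` is itself an indicator vector of an `N`-set. Otherwise an integral coordinate sum forces
a SECOND fractional coordinate (`exists_ne_of_fractional`); moving along `e_i − e_j` in both
directions until a face of the cube is hit writes `l` as a convex combination of two points of the
hypersimplex with fewer fractional coordinates (`sum_shift_eq` keeps the coordinate sum).
Everything is PROVED (0 sorry); no definitions, no named facts. Mathlib has the Birkhoff–von Neumann
theorem (`doublyStochastic_eq_convexHull_permMatrix`) but not this statement.

## References
* S. Herrmann, *On the facets of the secondary polytope*, J. Combin. Theory Ser. A 118 (2011)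
  425–447, §6 (the hypersimplex `Δ(k,n) = {x ∈ [0,1]^n : Σ x_i = k} = conv{Σ_{i∈A} e_i : |A| = k}`).
  [cite: Herrmann2011, §6]
* A. Schrijver, *Theory of Linear and Integer Programming* (Wiley, 1986), Cor. 19.2a (Hoffman–Kruskal:
  integrality of totally unimodular systems — an alternative route, not used here).
-/

namespace Literature.Analysis.Convex

open Finset

variable {κ : Type*} [Fintype κ] [DecidableEq κ]

/-- If a point of the unit cube `[0,1]^κ` has an integer coordinate sum and one coordinate strictly
between `0` and `1`, then it has a second such coordinate. [folklore] -/
private theorem exists_ne_of_fractional (l : κ → ℝ) (h0 : ∀ k, 0 ≤ l k) (h1 : ∀ k, l k ≤ 1) (N : ℕ)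
    (hs : ∑ k, l k = N) {i : κ} (hi : l i ≠ 0 ∧ l i ≠ 1) :
    ∃ j, j ≠ i ∧ l j ≠ 0 ∧ l j ≠ 1 := by
  by_contra hcon
  push Not at hcon
  -- every other coordinate is `0` or `1`
  have hint : ∀ j, j ≠ i → l j = if l j = 1 then 1 else 0 := by
    intro j hj
    by_cases h : l j = 1
    · rw [if_pos h, h]
    · rw [if_neg h]
      by_contra h'
      exact h (hcon j hj h')
  have hsplit : ∑ k, l k = l i + ∑ k ∈ univ.erase i, l k :=
    (Finset.add_sum_erase _ _ (mem_univ i)).symm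
  have hM : ∑ k ∈ univ.erase i, l k = (((univ.erase i).filter fun k => l k = 1).card : ℝ) := by
    rw [Finset.sum_congr rfl fun k hk => hint k (ne_of_mem_erase hk), Finset.sum_ite, sum_const_zero,
      add_zero, sum_const, nsmul_eq_mul, mul_one]
  set M := ((univ.erase i).filter fun k => l k = 1).card with hMdef
  have hli : l i = (N : ℝ) - M := by linarith [hsplit.symm.trans hs]
  have hpos : 0 < l i := lt_of_le_of_ne (h0 i) (Ne.symm hi.1)
  have hlt : l i < 1 := lt_of_le_of_ne (h1 i) hi.2
  rw [hli] at hpos hlt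
  have hMN : M < N := by exact_mod_cast (sub_pos.mp hpos)
  have : (M : ℝ) + 1 ≤ N := by exact_mod_cast hMN
  linarith

/-- Shifting weight `t` from coordinate `j` to coordinate `i ≠ j` preserves the coordinate sum.
[folklore] -/
private theorem sum_shift_eq (l : κ → ℝ) {i j : κ} (hij : i ≠ j) (t : ℝ) :
    ∑ k, (if k = i then l i + t else if k = j then l j - t else l k) = ∑ k, l k := by
  have h : ∀ k, (if k = i then l i + t else if k = j then l j - t else l k)
      = l k + ((if k = i then t else 0) - (if k = j then t else 0)) := by
    intro k
    by_cases hki : k = i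
    · subst hki; simp [hij]
    · by_cases hkj : k = j
      · subst hkj; simp [hki]; ring
      · simp [hki, hkj]
  simp_rw [h, Finset.sum_add_distrib, Finset.sum_sub_distrib, Finset.sum_ite_eq', mem_univ, if_true,
    sub_self, add_zero]

/-- **The hypersimplex is the convex hull of its `0/1` points** (induction on the number of
fractional coordinates): every `l ∈ [0,1]^κ` with `Σ_k l_k = N ∈ ℕ` is a convex combination
`l = Σ_S w_S 𝟙_S` of indicator vectors of `N`-subsets `S ⊆ κ`. [folklore] -/
private theorem exists_convexCombination_indicator_aux (n : ℕ) :
    ∀ l : κ → ℝ, (univ.filter fun k => l k ≠ 0 ∧ l k ≠ 1).card ≤ n → (∀ k, 0 ≤ l k) →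
      (∀ k, l k ≤ 1) → ∀ N : ℕ, ∑ k, l k = N →
      ∃ w : Finset κ → ℝ, (∀ S, 0 ≤ w S) ∧ (∀ S, w S ≠ 0 → S.card = N) ∧ ∑ S, w S = 1 ∧
        ∀ k, l k = ∑ S, w S * (if k ∈ S then 1 else 0) := by
  induction n with
  | zero =>
    intro l hF h0 h1 N hs
    have hint : ∀ k, l k = if l k = 1 then 1 else 0 := by
      intro k
      have hk : k ∉ univ.filter fun k => l k ≠ 0 ∧ l k ≠ 1 := by
        rw [Nat.le_zero, card_eq_zero] at hF
        rw [hF]; exact notMem_empty k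
      rw [mem_filter, not_and_or, not_and_or, not_not, not_not] at hk
      rcases hk with hk | hk | hk
      · exact absurd (mem_univ k) hk
      · rw [hk, if_neg (zero_ne_one' ℝ)]
      · rw [hk, if_pos rfl]
    set S₀ : Finset κ := univ.filter fun k => l k = 1 with hS₀
    have hcard : S₀.card = N := by
      have : (S₀.card : ℝ) = N := by
        rw [← hs, Finset.sum_congr rfl fun k _ => hint k, Finset.sum_ite, sum_const_zero, add_zero,
          sum_const, nsmul_eq_mul, mul_one]
      exact_mod_cast this
    refine ⟨fun S => if S = S₀ then 1 else 0, fun S => by positivity, fun S hS => ?_, ?_, fun k => ?_⟩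
    · by_cases h : S = S₀
      · rw [h, hcard]
      · exact (hS (by simp [h])).elim
    · rw [Finset.sum_ite_eq', if_pos (mem_univ _)]
    · simp_rw [ite_mul, one_mul, zero_mul, Finset.sum_ite_eq', mem_univ, if_true]
      rw [hint k]
      by_cases h : l k = 1 <;> simp [h, hS₀]
  | succ n ih =>
    intro l hF h0 h1 N hs
    by_cases hle : (univ.filter fun k => l k ≠ 0 ∧ l k ≠ 1).card ≤ n
    · exact ih l hle h0 h1 N hs
    -- there is a fractional coordinate `i`, hence a second one `j`
    obtain ⟨i, hi⟩ : (univ.filter fun k => l k ≠ 0 ∧ l k ≠ 1).Nonempty := by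
      rw [← card_pos]; omega
    have hi' := (mem_filter.mp hi).2
    obtain ⟨j, hji, hj0, hj1⟩ := exists_ne_of_fractional l h0 h1 N hs hi'
    have hij : i ≠ j := Ne.symm hji
    -- move along `e_i - e_j` in both directions until a face of the cube is hit
    set a := min (1 - l i) (l j) with ha
    set b := min (l i) (1 - l j) with hb
    have hli0 : 0 < l i := lt_of_le_of_ne (h0 i) (Ne.symm hi'.1)
    have hli1 : l i < 1 := lt_of_le_of_ne (h1 i) hi'.2
    have hlj0 : 0 < l j := lt_of_le_of_ne (h0 j) (Ne.symm hj0)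
    have hlj1 : l j < 1 := lt_of_le_of_ne (h1 j) hj1
    have ha0 : 0 < a := lt_min (by linarith) hlj0
    have hb0 : 0 < b := lt_min hli0 (by linarith)
    have hai : l i + a ≤ 1 := by have := min_le_left (1 - l i) (l j); linarith
    have haj : 0 ≤ l j - a := by have := min_le_right (1 - l i) (l j); linarith
    have hbi : 0 ≤ l i - b := by have := min_le_left (l i) (1 - l j); linarith
    have hbj : l j + b ≤ 1 := by have := min_le_right (l i) (1 - l j); linarith
    -- the two shifted points
    set lp : κ → ℝ := fun k => if k = i then l i + a else if k = j then l j - a else l k with hlp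
    set lm : κ → ℝ := fun k => if k = i then l i + -b else if k = j then l j - -b else l k with hlm
    -- fewer fractional coordinates: the filter shrinks strictly
    have hsub : ∀ (t : ℝ), (t = a ∨ t = -b) →
        (univ.filter fun k => (if k = i then l i + t else if k = j then l j - t else l k) ≠ 0 ∧
          (if k = i then l i + t else if k = j then l j - t else l k) ≠ 1) ⊂
        (univ.filter fun k => l k ≠ 0 ∧ l k ≠ 1) := by
      intro t ht
      rw [Finset.ssubset_iff_subset_ne]
      refine ⟨fun k hk => ?_, fun heq => ?_⟩
      · rw [mem_filter] at hk ⊢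
        refine ⟨mem_univ k, ?_⟩
        by_cases hki : k = i
        · subst hki; exact hi'
        · by_cases hkj : k = j
          · subst hkj; exact ⟨hj0, hj1⟩
          · simpa [hki, hkj] using hk.2
      · -- one of `i`, `j` became integral, so it left the filter
        rcases ht with rfl | rfl
        · -- `t = a`: either `l i + a = 1` or `l j - a = 0`
          by_cases hcase : 1 - l i ≤ l j
          · have : a = 1 - l i := min_eq_left hcase
            have hmem : i ∈ univ.filter fun k => l k ≠ 0 ∧ l k ≠ 1 := hi
            rw [← heq, mem_filter] at hmem
            simp only [if_true] at hmem
            exact hmem.2.2 (by rw [this]; ring)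
          · have : a = l j := min_eq_right (le_of_lt (not_le.mp hcase))
            have hmem : j ∈ univ.filter fun k => l k ≠ 0 ∧ l k ≠ 1 :=
              mem_filter.mpr ⟨mem_univ j, hj0, hj1⟩
            rw [← heq, mem_filter] at hmem
            simp only [hji, if_false, if_true] at hmem
            exact hmem.2.1 (by rw [this]; ring)
        · -- `t = -b`: either `l i - b = 0` or `l j + b = 1`
          by_cases hcase : l i ≤ 1 - l j
          · have : b = l i := min_eq_left hcase
            have hmem : i ∈ univ.filter fun k => l k ≠ 0 ∧ l k ≠ 1 := hi
            rw [← heq, mem_filter] at hmem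
            simp only [if_true] at hmem
            exact hmem.2.1 (by rw [this]; ring)
          · have : b = 1 - l j := min_eq_right (le_of_lt (not_le.mp hcase))
            have hmem : j ∈ univ.filter fun k => l k ≠ 0 ∧ l k ≠ 1 :=
              mem_filter.mpr ⟨mem_univ j, hj0, hj1⟩
            rw [← heq, mem_filter] at hmem
            simp only [hji, if_false, if_true] at hmem
            exact hmem.2.2 (by rw [this]; ring)
    have hcard_lt : ∀ (t : ℝ), (t = a ∨ t = -b) →
        (univ.filter fun k => (if k = i then l i + t else if k = j then l j - t else l k) ≠ 0 ∧
          (if k = i then l i + t else if k = j then l j - t else l k) ≠ 1).card ≤ n := by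
      intro t ht
      have := Finset.card_lt_card (hsub t ht)
      omega
    -- both shifted points lie in the cube and have coordinate sum `N`
    have hcube : ∀ (t : ℝ), (t = a ∨ t = -b) →
        (∀ k, 0 ≤ (if k = i then l i + t else if k = j then l j - t else l k)) ∧
        (∀ k, (if k = i then l i + t else if k = j then l j - t else l k) ≤ 1) := by
      intro t ht
      rcases ht with rfl | rfl
      · refine ⟨fun k => ?_, fun k => ?_⟩
        · by_cases hki : k = i
          · simp only [hki, if_true]; linarith
          · by_cases hkj : k = j
            · simp only [hkj, hji, if_false, if_true]; exact haj
            · simp only [hki, hkj, if_false]; exact h0 k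
        · by_cases hki : k = i
          · simp only [hki, if_true]; exact hai
          · by_cases hkj : k = j
            · simp only [hkj, hji, if_false, if_true]; linarith
            · simp only [hki, hkj, if_false]; exact h1 k
      · refine ⟨fun k => ?_, fun k => ?_⟩
        · by_cases hki : k = i
          · simp only [hki, if_true]; linarith
          · by_cases hkj : k = j
            · simp only [hkj, hji, if_false, if_true]; linarith
            · simp only [hki, hkj, if_false]; exact h0 k
        · by_cases hki : k = i
          · simp only [hki, if_true]; linarith
          · by_cases hkj : k = j
            · simp only [hkj, hji, if_false, if_true]; linarith
            · simp only [hki, hkj, if_false]; exact h1 k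
    obtain ⟨wp, hwp0, hwpN, hwp1, hwpl⟩ := ih lp (hcard_lt a (Or.inl rfl)) (hcube a (Or.inl rfl)).1
      (hcube a (Or.inl rfl)).2 N (by rw [hlp, sum_shift_eq l hij, hs])
    obtain ⟨wm, hwm0, hwmN, hwm1, hwml⟩ := ih lm (hcard_lt (-b) (Or.inr rfl))
      (hcube (-b) (Or.inr rfl)).1 (hcube (-b) (Or.inr rfl)).2 N (by rw [hlm, sum_shift_eq l hij, hs])
    -- the convex combination `l = (b/(a+b)) lp + (a/(a+b)) lm`
    have hab : 0 < a + b := by linarith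
    have hcomb : ∀ k, l k = b / (a + b) * lp k + a / (a + b) * lm k := by
      intro k
      rw [hlp, hlm]
      by_cases hki : k = i
      · simp only [hki, if_true]; field_simp; ring
      · by_cases hkj : k = j
        · simp only [hkj, hji, if_false, if_true]; field_simp; ring
        · simp only [hki, hkj, if_false]; field_simp; ring
    refine ⟨fun S => b / (a + b) * wp S + a / (a + b) * wm S, fun S => ?_, fun S hS => ?_, ?_,
      fun k => ?_⟩
    · have := hwp0 S; have := hwm0 S; positivity
    · by_contra hc
      have h1' : wp S = 0 := by by_contra h; exact hc (hwpN S h)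
      have h2' : wm S = 0 := by by_contra h; exact hc (hwmN S h)
      exact hS (show b / (a + b) * wp S + a / (a + b) * wm S = 0 by rw [h1', h2']; ring)
    · rw [Finset.sum_add_distrib, ← Finset.mul_sum, ← Finset.mul_sum, hwp1, hwm1]
      field_simp
      ring
    · rw [hcomb k, hwpl k, hwml k, Finset.mul_sum, Finset.mul_sum, ← Finset.sum_add_distrib]
      refine Finset.sum_congr rfl fun S _ => ?_
      ring

/-- **Hypersimplex decomposition** (`Δ(N, κ) = {l ∈ [0,1]^κ : Σ l = N}` is the convex hull of the
`0/1` vectors with `N` ones — Herrmann (2011) §6, first display; classical): every `l : κ → [0,1]`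
with `Σ_k l_k = N` (`N ∈ ℕ`) is a convex combination of indicator vectors of `N`-element subsets,
`l_k = Σ_{S ∋ k} w_S` with `w ≥ 0`, `Σ_S w_S = 1` and `w_S = 0` unless `|S| = N`.
[cite: Herrmann2011, §6 first display (hypersimplex as convex hull of its 0/1 points)] -/
theorem exists_convexCombination_indicator (l : κ → ℝ) (h0 : ∀ k, 0 ≤ l k) (h1 : ∀ k, l k ≤ 1)
    (N : ℕ) (hs : ∑ k, l k = N) :
    ∃ w : Finset κ → ℝ, (∀ S, 0 ≤ w S) ∧ (∀ S, w S ≠ 0 → S.card = N) ∧ ∑ S, w S = 1 ∧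
      ∀ k, l k = ∑ S, w S * (if k ∈ S then 1 else 0) :=
  exists_convexCombination_indicator_aux _ l le_rfl h0 h1 N hs

end Literature.Analysis.Convex
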